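import Mathlib.LinearAlgebra.BilinearForm.Orthogonal
import Mathlib.LinearAlgebra.Span.Basic
import Mathlib.RingTheory.Finiteness.Basic
import Mathlib.GroupTheory.Index
import Literature.AlgebraicGeometry.HodgeTheory.SkewVanishingLattice
import Summits.HodgeConjecture.HodgeConjecture.Theorems.LinearSystemTorelliLocalTubeSpanAlgebra
import Summits.HodgeConjecture.HodgeConjecture.Theorems.LinearSystemTorelliLocalTubeSpanFrameMod
import Summits.HodgeConjecture.HodgeConjecture.Theorems.LinearSystemTorelliLocalTubeSpanTransvections

/-!
# Route LinearSystemTorelli — crux `LocalTubeSpan`: one complete orbit with a radical ("RadicalProp12")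

Helper file (`--supports stmt-HodgeConjecture-2490`, line `Sketch`, stub `stub_radicalProp12`, the
cycle-2 hardest stub, taken by the line lead).  Setting of the crux at a ONE-BRANCH point `s₀` of the
discriminant (the refuters' residual stratum (N): two-component members `Y₁ ∪ Y₂`, where the local
discriminant is the cone over the irreducible dual variety of `Z = Y₁ ∩ Y₂`): the local fundamental
group acts on the vanishing cohomology `V = H^{2p-1}(X_s, ℚ)_van` (alternating intersection form `B`)
through Picard–Lefschetz transvections `T_δ(x) = x - B(x, δ) δ` along the local vanishing cycles,
which form a SINGLE orbit `Δ` (conjugate meridians) containing a pair with `⟨δ₁, δ₂⟩ = 1` (a cusp of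
`Δ_Z`), integral with `ℤΔ` finitely generated — i.e. `Δ` is a skew-symmetric vanishing lattice
(Janssen; [Schnell2010] §7) in its OWN span `L = ℚΔ ≤ V`, whose form is in general DEGENERATE: the
radical `R = L ∩ L^⊥` is the locally visible homology, and `L ≠ V`.

* `localTubeSpan_injective_evalCoinv_of_completeOrbit` — in that situation, granting Schnell's
  Lemma 11 (named fact `Schnell2010_lemma11`, from Janssen's Theorem 2.5 / Lemma 2.7), Schnell's third
  map `H¹(G, V) → ∏_{g ∈ G} V/(g - 1)V` is injective: every non-zero class is detected by a single
  element (for the visible classes: by a local Torelli element, acting trivially on `L`).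
* `localTubeSpan_injective_evalCoinv_of_vanishingLattice` — the case `ℚΔ = V`: C. Schnell,
  *Primitive cohomology and the tube mapping*, Math. Z. 268 (2010) §7 **Proposition 12** (the global
  step 3 of his Theorem 1 for even-dimensional `X`), in the tree's vocabulary
  (`IsSkewVanishingLattice`), conditional on Lemma 11.

Proof (the lead's; Schnell's argument run on the degenerate lattice `(L, Δ)` plus one new step):
`L` is `G`-stable and `G → GL(L)` has image the monodromy group `Γ_Δ(L)`; Lemma 11 gives a linearly
independent frame `δ₁, …, δ_r ∈ Δ` (`r = dim L`) whose transvection group has finite index in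
`Γ_Δ(L)`, so every generator `t` has `t^m = γκ` with `γ` in the frame group and `κ` acting trivially
on `L`; such `κ` is an isometry with `(κ - 1)V ⊆ L`, whence `B(y, (κ - 1)x) = B(κy, κx) - B(y, x) = 0`
for `y ∈ L`, i.e. `(κ - 1)V ⊆ R`.  The frame theorem modulo the stable submodule `M = R`
(`localTubeSpan_injective_evalCoinv_of_frame_mod`) then applies, because no generator's cycle lies in
`R` (it would make all of the single orbit `Δ` orthogonal to `L`, contradicting `⟨δ₁, δ₂⟩ = 1`).
The transvection calculus used (isometries, conjugates, image of `G` in `GL`) is the companion file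
`LinearSystemTorelliLocalTubeSpanTransvections`.
-/

-- `Summit.HodgeConjecture.HodgeConjecture.Theorems` is the mandated namespace (single-conjunct summit:
-- Sub = Summit), which `linter.dupNamespace` flags on every declaration; the lakefile turns the
-- linter off tree-wide (weak option), restated here so stand-alone elaboration is warning-free too.
set_option linter.dupNamespace false

noncomputable section

open CategoryTheory groupCohomology
open Literature.AlgebraicGeometry.HodgeTheory

namespace Summit.HodgeConjecture.HodgeConjecture.Theorems

/-! ### One complete orbit with a radical -/

section CompleteOrbit

variable {G : Type} [Group G] (A : Rep ℚ G)

/-- **Frame on the local lattice ⇒ injectivity (vocabulary-free core of "RadicalProp12").**  Let `G`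
act on the finite-dimensional `ℚ`-space `V = A` with an alternating form `B`, generated by a set `s` of
elements acting as transvections `x ↦ x - B(x, δ)δ` along members of a set `Δ ⊆ V` none of which
lies in the radical `R = L ∩ L^⊥` of the local lattice `L = ℚΔ`.  Suppose there is a linearly
independent frame `δ'_i` realised by elements `u_i ∈ G` as transvections, such that every generator has a
positive power agreeing ON `L` with an element of the frame group `⟨u_i⟩` (finite index of the frame
group in the image of `G → GL(L)` — what Schnell's Lemma 11 supplies for a complete orbit).  Then
Schnell's third map `H¹(G, V) → ∏_g V/(g - 1)V` is injective.  (The discrepancy `κ = γ⁻¹ t^m` acts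
trivially on `L`, is an isometry and moves `V` into `L`, hence `(κ - 1)V ⊆ R`; apply the frame
theorem modulo `R`.) [cite: Schnell2010, §7 Prop. 12 (proof)] -/
theorem localTubeSpan_injective_evalCoinv_of_frame_on_span [FiniteDimensional ℚ A.V]
    (B : LinearMap.BilinForm ℚ A.V) (hB : B.IsAlt) (Δ : Set A.V)
    (s : Set G) (hs : Subgroup.closure s = ⊤)
    (hsΔ : ∀ t ∈ s, ∃ δ ∈ Δ, ∀ x : A.V, A.ρ t x = x - B x δ • δ)
    (hnotR : ∀ δ ∈ Δ, δ ∉ Submodule.span ℚ Δ ⊓ B.orthogonal (Submodule.span ℚ Δ))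
    {r : ℕ} (u : Fin r → G) (δ' : Fin r → A.V)
    (hli : LinearIndependent ℚ δ') (hu : ∀ (i : Fin r) (x : A.V), A.ρ (u i) x = x - B x (δ' i) • δ' i)
    (hvirtL : ∀ t ∈ s, ∃ m : ℕ, 0 < m ∧ ∃ γ ∈ Subgroup.closure (Set.range u),
      ∀ x ∈ Submodule.span ℚ Δ, A.ρ (t ^ m) x = A.ρ γ x) :
    Function.Injective (evalCoinv A) := by
  classical
  -- the generators' cycles
  choose! ecyc hecycΔ hecyc using hsΔ
  -- isometries
  have hiso : ∀ (g : G) (x y : A.V), B (A.ρ g x) (A.ρ g y) = B x y :=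
    localTubeSpan_isometry_of_generators B A.ρ s hs fun t ht =>
      localTubeSpan_isometry_of_transvection_formula B hB (ecyc t) (A.ρ t) (hecyc t ht)
  -- the local lattice `L = ℚΔ` is `G`-stable; `(g - 1)V ⊆ L`
  set L : Submodule ℚ A.V := Submodule.span ℚ Δ with hLdef
  have hsubL : ∀ g : G, subOneRange A g ≤ L := fun g =>
    localTubeSpan_subOneRange_le_of_closure_eq_top A s hs L (fun t ht =>
      (localTubeSpan_range_sub_id_le_span_of_formula B (ecyc t) (A.ρ t) (hecyc t ht)).trans
        ((Submodule.span_singleton_le_iff_mem _ _).2 (Submodule.subset_span (hecycΔ t ht)))) g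
  -- the radical `R = L ∩ L^⊥` is fixed pointwise
  set R : Submodule ℚ A.V := L ⊓ B.orthogonal L with hRdef
  have hRfix : ∀ (g : G), ∀ v ∈ R, A.ρ g v = v := by
    intro g v hv
    have hg : g ∈ Subgroup.closure s := by rw [hs]; exact Subgroup.mem_top g
    induction hg using Subgroup.closure_induction with
    | mem t ht =>
        have h0 : B v (ecyc t) = 0 := by
          have h1 : B (ecyc t) v = 0 :=
            (LinearMap.BilinForm.mem_orthogonal_iff.1 hv.2) _ (Submodule.subset_span (hecycΔ t ht))
          rw [← hB.neg_eq, h1, neg_zero]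
        rw [hecyc t ht, h0, zero_smul, sub_zero]
    | one => simp
    | mul g h _ _ ihg ihh => rw [map_mul, Module.End.mul_apply, ihh, ihg]
    | inv g _ ih =>
        have := congrArg (A.ρ g⁻¹) ih
        rwa [← Module.End.mul_apply, ← map_mul, inv_mul_cancel, map_one, Module.End.one_apply,
          eq_comm] at this
  have hRstab : ∀ (g : G), ∀ v ∈ R, A.ρ g v ∈ R := fun g v hv => by
    rw [hRfix g v hv]; exact hv
  -- apply the frame theorem modulo `R`
  refine localTubeSpan_injective_evalCoinv_of_frame_mod A s hs ecyc
    (fun t ht => localTubeSpan_range_sub_id_le_span_of_formula B (ecyc t) (A.ρ t) (hecyc t ht))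
    (fun t ht => by rw [hecyc t ht, hB.self_eq_zero, zero_smul, sub_zero]) u δ' hli
    (fun i => localTubeSpan_range_sub_id_le_span_of_formula B (δ' i) (A.ρ (u i)) (hu i))
    R hRstab (fun t ht => ?_) (fun t ht => ?_)
  · -- `ℚ·δ_t ∩ R = 0`
    refine (Submodule.eq_bot_iff _).2 fun v hv => ?_
    obtain ⟨c, rfl⟩ := Submodule.mem_span_singleton.1 hv.1
    by_cases hc : c = 0
    · rw [hc, zero_smul]
    · exfalso
      refine hnotR (ecyc t) (hecycΔ t ht) ?_
      have := R.smul_mem c⁻¹ hv.2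
      rwa [smul_smul, inv_mul_cancel₀ hc, one_smul] at this
  · -- a positive power of `t` lies in (frame group)·(kernel of `G → GL(L)`)
    obtain ⟨m, hmpos, γ, hγ, hγL⟩ := hvirtL t ht
    refine ⟨m, hmpos, ?_⟩
    have e1 : t ^ m = γ * (γ⁻¹ * t ^ m) := by group
    rw [e1]
    refine Subgroup.mul_mem _ (Subgroup.closure_mono Set.subset_union_left hγ)
      (Subgroup.subset_closure (Or.inr ?_))
    -- `κ = γ⁻¹ t^m` acts trivially on `L`, hence `(κ - 1)V ⊆ R`
    have hκL : ∀ x ∈ L, A.ρ (γ⁻¹ * t ^ m) x = x := fun x hx => by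
      rw [map_mul, Module.End.mul_apply, hγL x hx, ← Module.End.mul_apply, ← map_mul,
        inv_mul_cancel, map_one, Module.End.one_apply]
    rintro _ ⟨x, rfl⟩
    refine ⟨hsubL _ ⟨x, rfl⟩, LinearMap.BilinForm.mem_orthogonal_iff.2 fun y hy => ?_⟩
    rw [LinearMap.sub_apply, LinearMap.id_apply, map_sub]
    have e2 : B y (A.ρ (γ⁻¹ * t ^ m) x) = B y x := by
      calc B y (A.ρ (γ⁻¹ * t ^ m) x) = B (A.ρ (γ⁻¹ * t ^ m) y) (A.ρ (γ⁻¹ * t ^ m) x) := by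
            rw [hκL y hy]
        _ = B y x := hiso _ y x
    rw [e2, sub_self]

/-- **The local Schnell theorem at a one-branch point ("RadicalProp12")** — Transfer C⁺ of the
crux idea cards central-meridian-inflation (S4) / pencil-configuration-janssen (P4), corrected.
Let `G` act on the finite-dimensional `ℚ`-space `V = A` carrying an alternating form `B`, and be
generated by a set `s` of elements acting as Picard–Lefschetz transvections
`x ↦ x - B(x, δ) δ` along members of a set `Δ ⊆ V` such that every `T_δ`, `δ ∈ Δ`, is realised
by an element of `G`.  Assume `Δ` is `G`-stable and a single `G`-orbit, integral (`B(δ, δ') ∈ ℤ`),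
with `ℤΔ` finitely generated, and contains `δ₁, δ₂` with `B(δ₁, δ₂) = 1` — a skew-symmetric
vanishing lattice in its own span `L = ℚΔ`, of possibly DEGENERATE form and with possibly `L ≠ V`.
Then, granting Schnell's Lemma 11 (Janssen), Schnell's third map `H¹(G, V) → ∏_{g ∈ G} V/(g - 1)V`
is injective. [cite: Schnell2010, §7 Prop. 12 and Lemma 11] -/
theorem localTubeSpan_injective_evalCoinv_of_completeOrbit (hL11 : Schnell2010_lemma11)
    [FiniteDimensional ℚ A.V] (B : LinearMap.BilinForm ℚ A.V) (hB : B.IsAlt) (Δ : Set A.V)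
    (s : Set G) (hs : Subgroup.closure s = ⊤)
    (hsΔ : ∀ t ∈ s, ∃ δ ∈ Δ, ∀ x : A.V, A.ρ t x = x - B x δ • δ)
    (hΔG : ∀ δ ∈ Δ, ∃ g : G, ∀ x : A.V, A.ρ g x = x - B x δ • δ)
    (hfg : (Submodule.span ℤ Δ).FG) (hint : ∀ δ ∈ Δ, ∀ δ' ∈ Δ, ∃ n : ℤ, B δ δ' = n)
    (hstable : ∀ (g : G), ∀ δ ∈ Δ, A.ρ g δ ∈ Δ)
    (htrans : ∀ δ ∈ Δ, ∀ δ' ∈ Δ, ∃ g : G, A.ρ g δ = δ')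
    (hpair : ∃ δ₁ ∈ Δ, ∃ δ₂ ∈ Δ, B δ₁ δ₂ = 1) :
    Function.Injective (evalCoinv A) := by
  classical
  -- the generators' cycles
  choose! ecyc hecycΔ hecyc using hsΔ
  -- isometries
  have hiso : ∀ (g : G) (x y : A.V), B (A.ρ g x) (A.ρ g y) = B x y :=
    localTubeSpan_isometry_of_generators B A.ρ s hs fun t ht =>
      localTubeSpan_isometry_of_transvection_formula B hB (ecyc t) (A.ρ t) (hecyc t ht)
  -- the local lattice `L = ℚΔ` is `G`-stable; `(g - 1)V ⊆ L`
  set L : Submodule ℚ A.V := Submodule.span ℚ Δ with hLdef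
  have hsubL : ∀ g : G, subOneRange A g ≤ L := fun g =>
    localTubeSpan_subOneRange_le_of_closure_eq_top A s hs L (fun t ht =>
      (localTubeSpan_range_sub_id_le_span_of_formula B (ecyc t) (A.ρ t) (hecyc t ht)).trans
        ((Submodule.span_singleton_le_iff_mem _ _).2 (Submodule.subset_span (hecycΔ t ht)))) g
  have hLstab : ∀ (g : G), ∀ x ∈ L, A.ρ g x ∈ L := fun g x hx => by
    have h1 : A.ρ g x - x ∈ L := hsubL g ⟨x, rfl⟩
    have h2 : A.ρ g x = (A.ρ g x - x) + x := by abel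
    rw [h2]
    exact L.add_mem h1 hx
  -- no cycle of `Δ` lies in the radical `R = L ∩ L^⊥`
  obtain ⟨δ₁, hδ₁, δ₂, hδ₂, h12⟩ := hpair
  have hnotR : ∀ δ ∈ Δ, δ ∉ L ⊓ B.orthogonal L := by
    intro δ hδ hδR
    -- every `δ' ∈ Δ` is then orthogonal to `L`
    have horth : ∀ δ' ∈ Δ, ∀ y ∈ L, B y δ' = 0 := by
      intro δ' hδ' y hy
      obtain ⟨g, hg⟩ := htrans δ hδ δ' hδ'
      have hy' : A.ρ g⁻¹ y ∈ L := hLstab _ y hy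
      have e1 : B y δ' = B (A.ρ g⁻¹ y) δ := by
        rw [← hg, ← hiso g (A.ρ g⁻¹ y) δ, ← Module.End.mul_apply, ← map_mul, mul_inv_cancel,
          map_one, Module.End.one_apply]
      rw [e1]
      exact (LinearMap.BilinForm.mem_orthogonal_iff.1 hδR.2) _ hy'
    have : B δ₁ δ₂ = 0 := horth δ₂ hδ₂ δ₁ (Submodule.subset_span hδ₁)
    rw [h12] at this
    exact one_ne_zero this
  -- the restricted representation on `L` and the restricted (degenerate) lattice
  let resL : G →* (L →ₗ[ℚ] L) :=
    { toFun := fun g => (A.ρ g).restrict (hLstab g)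
      map_one' := by
        refine LinearMap.ext fun x => Subtype.ext ?_
        simp
      map_mul' := fun g h => by
        refine LinearMap.ext fun x => Subtype.ext ?_
        simp }
  have hresL : ∀ (g : G) (x : L), ((resL g x : L) : A.V) = A.ρ g x := fun g x => rfl
  let B' : LinearMap.BilinForm ℚ L := B.restrict L
  have hB'ap : ∀ x y : L, B' x y = B x y := fun x y => rfl
  have hB' : B'.IsAlt := fun x => hB (x : A.V)
  let Δ' : Set L := {x : L | (x : A.V) ∈ Δ}
  -- a transvection of `V` along `δ ∈ L` restricts to the transvection of `L`
  have hrestrT : ∀ (g : G) (δ : L), (∀ x : A.V, A.ρ g x = x - B x δ • (δ : A.V)) →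
      resL g = skewTransvection B' δ := fun g δ hg => by
    refine LinearMap.ext fun x => Subtype.ext ?_
    rw [hresL, hg, skewTransvection_apply, Submodule.coe_sub, Submodule.coe_smul, hB'ap]
  have hsT' : ∀ t ∈ s, ∃ δ ∈ Δ', resL t = skewTransvection B' δ := fun t ht =>
    ⟨⟨ecyc t, Submodule.subset_span (hecycΔ t ht)⟩, hecycΔ t ht,
      hrestrT t ⟨ecyc t, _⟩ (hecyc t ht)⟩
  have hreal' : ∀ δ ∈ Δ', ∃ g : G, resL g = skewTransvection B' δ := fun δ hδ => by
    obtain ⟨g, hg⟩ := hΔG (δ : A.V) hδ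
    exact ⟨g, hrestrT g δ hg⟩
  -- `Δ'` is a skew vanishing lattice in `L`
  have hΔ' : IsSkewVanishingLattice B' Δ' := by
    refine ⟨?_, ?_, ?_, ?_, ?_, ?_⟩
    · -- `ℤΔ'` is finitely generated: its image under the injective `L → V` is `ℤΔ`
      let ι : L →ₗ[ℤ] A.V := L.subtype.restrictScalars ℤ
      refine Submodule.fg_of_fg_map_injective ι (fun x y h => Subtype.ext h) ?_
      have himg : (ι : L → A.V) '' Δ' = Δ := by
        ext v
        constructor
        · rintro ⟨x, hx, rfl⟩; exact hx
        · intro hv; exact ⟨⟨v, Submodule.subset_span hv⟩, hv, rfl⟩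
      rw [Submodule.map_span, himg]
      exact hfg
    · intro δ hδ δ' hδ'
      exact hint _ hδ _ hδ'
    · -- `Δ'` spans `L`
      exact Submodule.span_span_coe_preimage
    · -- stable
      intro γ hγ δ hδ
      obtain ⟨g, hg⟩ :=
        localTubeSpan_exists_toHomUnits_eq_of_mem_transvectionGroup B' Δ' resL s hs hsT' hreal' hγ
      change ((γ : L →ₗ[ℚ] L) δ : A.V) ∈ Δ
      rw [← hg, hresL]
      exact hstable g _ hδ
    · -- transitive
      intro δ hδ δ' hδ'
      obtain ⟨g, hg⟩ := htrans _ hδ _ hδ'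
      refine ⟨resL.toHomUnits g,
        localTubeSpan_toHomUnits_mem_transvectionGroup B' Δ' resL s hs hsT' hreal' g, ?_⟩
      exact Subtype.ext (by rw [MonoidHom.coe_toHomUnits, hresL, hg])
    · exact ⟨⟨δ₁, Submodule.subset_span hδ₁⟩, hδ₁, ⟨δ₂, Submodule.subset_span hδ₂⟩, hδ₂, h12⟩
  -- Lemma 11: a linearly independent frame in `Δ'` whose transvections have finite index
  obtain ⟨r, δ', -, hδ'Δ, hli, hfi⟩ := hL11 L B' hB' Δ' hΔ'
  -- the frame upstairs
  let δfr : Fin r → A.V := fun i => (δ' i : A.V)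
  have hδfr : LinearIndependent ℚ δfr := hli.map' L.subtype (Submodule.ker_subtype L)
  have hδfrΔ : ∀ i, δfr i ∈ Δ := fun i => hδ'Δ i
  choose u hu using fun i => hΔG (δfr i) (hδfrΔ i)
  -- the frame group upstairs maps onto the frame group of `L`
  have hframe : transvectionGroup B' (Set.range δ') ≤
      (Subgroup.closure (Set.range u)).map resL.toHomUnits := by
    unfold transvectionGroup
    refine (Subgroup.closure_le _).2 ?_
    rintro w ⟨_, ⟨i, rfl⟩, hw⟩
    refine ⟨u i, Subgroup.subset_closure ⟨i, rfl⟩, Units.ext ?_⟩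
    rw [MonoidHom.coe_toHomUnits, hw]
    exact hrestrT (u i) (δ' i) (hu i)
  -- finite index downstairs ⇒ every generator has a power agreeing on `L` with a frame element
  refine localTubeSpan_injective_evalCoinv_of_frame_on_span A B hB Δ s hs
    (fun t ht => ⟨ecyc t, hecycΔ t ht, hecyc t ht⟩) hnotR u δfr hδfr hu fun t ht => ?_
  have htmem : resL.toHomUnits t ∈ transvectionGroup B' Δ' :=
    localTubeSpan_toHomUnits_mem_transvectionGroup B' Δ' resL s hs hsT' hreal' t
  haveI := hfi
  obtain ⟨m, hmpos, -, hm⟩ := Subgroup.exists_pow_mem_of_index_ne_zero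
    (Subgroup.FiniteIndex.index_ne_zero
      (H := (transvectionGroup B' (Set.range δ')).subgroupOf (transvectionGroup B' Δ')))
    (⟨resL.toHomUnits t, htmem⟩ : transvectionGroup B' Δ')
  rw [Subgroup.mem_subgroupOf, SubgroupClass.coe_pow, ← map_pow] at hm
  obtain ⟨γ, hγ, hγeq⟩ := hframe hm
  refine ⟨m, hmpos, γ, hγ, fun x hx => ?_⟩
  have h2 := congrArg (fun w : (L →ₗ[ℚ] L)ˣ => (((w : L →ₗ[ℚ] L) ⟨x, hx⟩ : L) : A.V)) hγeq
  simpa only [MonoidHom.coe_toHomUnits, hresL] using h2.symm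

/-- **Schnell's Proposition 12** ([Schnell2010] §7), conditional on his Lemma 11 (Janssen).  Let
`G` act on the finite-dimensional `ℚ`-space `V = A` with an alternating form `B`, generated by a
set `s` of elements acting as transvections `x ↦ x - B(x, δ)δ` along members of a skew-symmetric
vanishing lattice `Δ ⊆ V` (`IsSkewVanishingLattice B Δ`: `ℤΔ` finitely generated, `B` integral on
`Δ`, `ℚΔ = V`, `Δ` a single `Γ_Δ`-orbit, a pair with `⟨δ₁, δ₂⟩ = 1`) all of whose transvections are
realised in `G` (so that the image of `G` is `Γ_Δ`).  Then the restriction map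
`H¹(G, V) → ∏_{g ∈ G} V/(g - 1)V` is injective.  In [Schnell2010] this is step 3 of the proof of
Theorem 1 for even-dimensional `X` (`V = H^{d-1}(X_s, ℚ)_van`, `G = π₁(P^{sm})`, `s` the meridians
of a Lefschetz pencil, `Δ` = all vanishing cycles). [cite: Schnell2010, §7 Prop. 12] -/
theorem localTubeSpan_injective_evalCoinv_of_vanishingLattice (hL11 : Schnell2010_lemma11)
    [FiniteDimensional ℚ A.V] (B : LinearMap.BilinForm ℚ A.V) (hB : B.IsAlt) (Δ : Set A.V)
    (hΔ : IsSkewVanishingLattice B Δ) (s : Set G) (hs : Subgroup.closure s = ⊤)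
    (hsΔ : ∀ t ∈ s, ∃ δ ∈ Δ, ∀ x : A.V, A.ρ t x = x - B x δ • δ)
    (hΔG : ∀ δ ∈ Δ, ∃ g : G, ∀ x : A.V, A.ρ g x = x - B x δ • δ) :
    Function.Injective (evalCoinv A) := by
  -- the image of `G` in `GL(V)` is `Γ_Δ`
  have hsT : ∀ t ∈ s, ∃ δ ∈ Δ, A.ρ t = skewTransvection B δ := fun t ht => by
    obtain ⟨δ, hδ, h⟩ := hsΔ t ht
    exact ⟨δ, hδ, LinearMap.ext fun x => by rw [h, skewTransvection_apply]⟩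
  have hreal : ∀ δ ∈ Δ, ∃ g : G, A.ρ g = skewTransvection B δ := fun δ hδ => by
    obtain ⟨g, h⟩ := hΔG δ hδ
    exact ⟨g, LinearMap.ext fun x => by rw [h, skewTransvection_apply]⟩
  refine localTubeSpan_injective_evalCoinv_of_completeOrbit A hL11 B hB Δ s hs hsΔ hΔG hΔ.fg
    hΔ.integral (fun g δ hδ => ?_) (fun δ hδ δ' hδ' => ?_) hΔ.exists_pair
  · have := hΔ.stable _
      (localTubeSpan_toHomUnits_mem_transvectionGroup B Δ A.ρ s hs hsT hreal g) δ hδ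
    rwa [MonoidHom.coe_toHomUnits] at this
  · obtain ⟨γ, hγ, hγδ⟩ := hΔ.transitive δ hδ δ' hδ'
    obtain ⟨g, hg⟩ :=
      localTubeSpan_exists_toHomUnits_eq_of_mem_transvectionGroup B Δ A.ρ s hs hsT hreal hγ
    exact ⟨g, by rw [hg, hγδ]⟩

end CompleteOrbit

end Summit.HodgeConjecture.HodgeConjecture.Theorems

end
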